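import Mathlib
import HarnessLib
import Summits.NavierStokesRegularity.NavierStokesRegularity.Theses.LocalSineTubeDoor
import Summits.NavierStokesRegularity.NavierStokesRegularity.Theorems.LocalSineTubeDoorProfileAlignedWindowRigidity
import Summits.NavierStokesRegularity.NavierStokesRegularity.Theorems.LocalSineTubeDoorLocalPointZoom

/-!
# Route `LocalSineTubeDoor` — the rung leaf N0-`LocalTubeDoorSine` (item `Target`, stmt-NavierStokesRegularity-20016)
# and `Assembly` (stmt-NavierStokesRegularity-20019) are THEOREMS

Cell ns-regularity-ideate, seat p6.  Both cruxes of the route are tree theorems —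
`Theorems.LocalSineTubeDoorLocalPointZoom.localPointZoom_proof : …Theses.LocalSineTubeDoor.LocalPointZoom` (K1)
and `Theorems.LocalSineTubeDoorProfileAlignedWindowRigidity.profileAlignedWindowRigidity_proof :
…Theses.LocalSineTubeDoor.ProfileAlignedWindowRigidity` (K2) — and the route's gate-certified deciding theorem
`Theses.LocalSineTubeDoor.closes : LocalPointZoom → ProfileAlignedWindowRigidity → Target` (the sign-blind,
scale-critical limit passage) composes them:

* `assembly_proof : …Theses.LocalSineTubeDoor.Assembly`;
* `target_proof : …Theses.LocalSineTubeDoor.Target` — the door N0-`LocalTubeDoorSine`: a classical Leray–Hopf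
  solution from a rapidly decaying datum, LOCALLY Type I at `(x₀,T)` on one parabolic cylinder, whose vorticity
  directions are SINE-coherent above every scale-critical level over ONE nonempty open window of similarity
  coordinates, is backward bounded at `(x₀,T)`.

WHAT THIS IS NOT: not a claim about Navier–Stokes regularity (Clay A).  The leaf is a regularity CRITERION
(hypothesis: local Type I + window sine-coherence); it is one rung of LADDER-NS N0 and says nothing about
solutions without the coherence hypothesis.  Establishment in the cell's sense still requires the cross-family
referee PASS + independent reproduction.
-/

noncomputable section

namespace Summit.NavierStokesRegularity.NavierStokesRegularity.Theorems.LocalSineTubeDoorTarget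

open Summit.NavierStokesRegularity.NavierStokesRegularity.Theses.LocalSineTubeDoor
open Summit.NavierStokesRegularity.NavierStokesRegularity.Theorems.LocalSineTubeDoorProfileAlignedWindowRigidity
open Summit.NavierStokesRegularity.NavierStokesRegularity.Theorems.LocalSineTubeDoorLocalPointZoom

/-- **The route's `Assembly` item (stmt-NavierStokesRegularity-20019)**: `LocalPointZoom → ProfileAlignedWindowRigidity
→ Target`, by the gate-certified deciding theorem `closes` of the route file. -/
theorem assembly_proof :
    Summit.NavierStokesRegularity.NavierStokesRegularity.Theses.LocalSineTubeDoor.Assembly :=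
  fun h₁ h₂ => closes h₁ h₂

/-- **The rung leaf N0-`LocalTubeDoorSine` (the route's `Target`, stmt-NavierStokesRegularity-20016) is a
THEOREM**: `closes localPointZoom_proof profileAlignedWindowRigidity_proof`. -/
theorem target_proof :
    Summit.NavierStokesRegularity.NavierStokesRegularity.Theses.LocalSineTubeDoor.Target :=
  closes localPointZoom_proof profileAlignedWindowRigidity_proof

end Summit.NavierStokesRegularity.NavierStokesRegularity.Theorems.LocalSineTubeDoorTarget

end
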